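import Summits.Ventures.WeilGRH.RigidityDataA72
import HarnessLib

/-!
# rh-explicit (venture WeilGRH): validity of the rung's special-value table (`a = 18/25`, prime powers `[⟨2, 1⟩, ⟨3, 1⟩, ⟨2, 2⟩]`) (weil-3 gen20)

Cell `rh-explicit`, WEIL TRACK (structure seat weil-3, gen20).  Alternative rung of the QUADRATIC ladder «(−7/·) fifth»: π/a = 4.3633.  Kernel certificates only: one Boolean conjunction (`checks_A72`), two
table-slice checks, and ONE propositional conjunction (`inputs_valid`: `0 < a ∧ PrimeData a ks ∧ ConstsValid (2^80) a ks C ∧ TabValid (2^80) a ks 21 tab`).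
Inputs: `π ∈ P`, `a = 18/25 ∈ A` (`checkFrac`), the constants record, the prime data (`checkPrimeDataSep … kmax = 4`) and the table
slices `[0, 11)`, `[11, 21)` of `RigidityDataA72.tab`.  Statements QUALIFIED `Christoffel.A72.*` (the textual-duplicate lint compares table checks
across rungs).  Same shape as `RigidityTableA53`.  RH-free; no definitions; standard axioms; nothing here bears on the truth of RH.
-/

set_option linter.dupNamespace false
set_option maxRecDepth 200000
set_option autoImplicit false

namespace Summit.Ventures.WeilGRH.Christoffel.A72

open Literature.NumberTheory.LFunctions Literature.NumberTheory.LFunctions.Yoshida1992 Encl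
  Literature.Analysis.ValidatedNumerics.NumericsMP

set_option maxHeartbeats 0 in
/-- kernel: `π ∈ P`, `a = 18/25 ∈ A`, the constants record and the prime data — one conjunction. -/
theorem checks_A72 :
    (checkPi (2 ^ 80) 70 Christoffel.A72.P && checkFrac (2 ^ 80) 18 25 Christoffel.A72.A &&
      checkConsts Christoffel.A72.prm Christoffel.A72.P Christoffel.A72.A Christoffel.A72.ks Christoffel.A72.C &&
      checkPrimeDataSep (2 ^ 80) 96 Christoffel.A72.A 4 Christoffel.A72.ks) = true := by
  decide +kernel

set_option maxHeartbeats 0 in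
/-- kernel: table slice `[0, 11)`, recomputed and contained. -/
theorem table_A72_A : checkTable Christoffel.A72.prm Christoffel.A72.C Christoffel.A72.tab 0 11 = true := by
  decide +kernel

set_option maxHeartbeats 0 in
/-- kernel: table slice `[11, 21)`. -/
theorem table_A72_B : checkTable Christoffel.A72.prm Christoffel.A72.C Christoffel.A72.tab 11 10 = true := by
  decide +kernel

/-- **The inputs of the certificates are valid**: `0 < a`, the prime data of the window, the constants record, and the special-value table
below mode `21`. -/
theorem inputs_valid :
    (0 : ℝ) < Christoffel.A72.a ∧ PrimeData Christoffel.A72.a Christoffel.A72.ks ∧ ConstsValid (2 ^ 80) Christoffel.A72.a Christoffel.A72.ks Christoffel.A72.C ∧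
      TabValid (2 ^ 80) Christoffel.A72.a Christoffel.A72.ks 21 Christoffel.A72.tab := by
  have h := checks_A72
  simp only [Bool.and_eq_true] at h
  obtain ⟨⟨⟨hP, hA⟩, hC⟩, hK⟩ := h
  have hT0 := table_A72_A
  have hT1 := table_A72_B
  have ha0 : (0 : ℝ) < a := by unfold a; norm_num
  have hpi : MI.mem (2 ^ 80) Real.pi P := mem_pi_of_checkPi (by norm_num) hP
  have ha : MI.mem (2 ^ 80) a A := by
    unfold a
    exact mem_of_checkFrac (S := 2 ^ 80) hA
  have hc : ConstsValid (2 ^ 80) a ks C :=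
    constsValid_of_checkConsts (prm := prm) (by norm_num [prm]) (by norm_num [prm]) hpi ha hC
  have hk : PrimeData a ks := primeData_of_checkSep (S := 2 ^ 80) (by norm_num) ha hK
  have h1 : TabValid (2 ^ 80) a ks (0 + 11) tab :=
    (TabValid.zero (S := 2 ^ 80) (a := a) (ks := ks) (tab := tab)).extend fun n hn hnk ↦
      idxValid_of_checkTable (prm := prm) (by norm_num [prm]) ha0 hc hT0 hn hnk
  exact ⟨ha0, hk, hc, h1.extend fun n hn hnk ↦ idxValid_of_checkTable (prm := prm) (by norm_num [prm]) ha0 hc hT1 hn hnk⟩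

end Summit.Ventures.WeilGRH.Christoffel.A72
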